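import Mathlib
import HarnessLib

/-!
# The vertical shear chart of `ℝ³` over the base plane

(Line `janus-bands`, crux `ArrangementNormalForm`, stub `stub_separateThreeZero`, part `HIChart` of
the termwise numerator split `separateThree_hI` under the rim condition.)

The measure-preserving measurable equivalence
`chart3 : (Fin (2 + 1) → ℝ) ≃ᵐ (Fin 2 → ℝ) × ℝ`, `z ↦ (x′, y − ℓ(x′))` (`x′ = (z 0, z 1)` the base
point, `y = z 2` the distinguished coordinate, `ℓ` an affine form on the base plane), in which the
pole plane `y = ℓ(x′)` becomes `w = 0` and the vertical lines become the fibres `{v} × ℝ`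
(`chart3_apply`, `measurePreserving_chart3`, registered as `separateThree_chart`). It is the
composite of Mathlib's `MeasurableEquiv.piFinSuccAbove` at the last coordinate, the swap, and the
shear `(v, y) ↦ (v, y − ℓ(v))`.
-/

noncomputable section

open Set MeasureTheory Filter Topology

namespace Summit.KontsevichZagierPeriods.ArrangementNormalForm.JanusBands

namespace SepThree

/-- An affine form on the base plane: `ℓ(v) = l₀ v 0 + l₁ v 1 + l₂`. -/
def affv (l : ℝ × ℝ × ℝ) (v : Fin 2 → ℝ) : ℝ := l.1 * v 0 + l.2.1 * v 1 + l.2.2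

/-- The affine form is continuous. -/
theorem continuous_affv (l : ℝ × ℝ × ℝ) : Continuous (affv l) := by unfold affv; fun_prop

/-- The affine form is measurable. -/
theorem measurable_affv (l : ℝ × ℝ × ℝ) : Measurable (affv l) := (continuous_affv l).measurable

/-- The shear `(v, y) ↦ (v, y − ℓ(v))` as a homeomorphism. -/
def shearHomeo (l : ℝ × ℝ × ℝ) : (Fin 2 → ℝ) × ℝ ≃ₜ (Fin 2 → ℝ) × ℝ where
  toFun p := (p.1, p.2 - affv l p.1)
  invFun p := (p.1, p.2 + affv l p.1)
  left_inv p := by ext <;> simp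
  right_inv p := by ext <;> simp
  continuous_toFun := by
    have := continuous_affv l
    fun_prop
  continuous_invFun := by
    have := continuous_affv l
    fun_prop

/-- The shear preserves Lebesgue measure. -/
theorem measurePreserving_shear (l : ℝ × ℝ × ℝ) :
    MeasurePreserving (shearHomeo l) (volume : Measure ((Fin 2 → ℝ) × ℝ)) volume := by
  have h := (MeasurePreserving.id (volume : Measure (Fin 2 → ℝ))).skew_product
    (g := fun v y => y - affv l v) (by
      have := measurable_affv l
      fun_prop)
    (Eventually.of_forall fun v => (measurePreserving_sub_right (volume : Measure ℝ) (affv l v)).map_eq)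
  exact h

/-- The base point of `z : Fin (2 + 1) → ℝ`. -/
def bse (z : Fin (2 + 1) → ℝ) : Fin 2 → ℝ := fun i => z (Fin.castSucc i)

/-- **The vertical shear chart** `z ↦ (x′, y − ℓ(x′))`. -/
def chart3 (l : ℝ × ℝ × ℝ) : (Fin (2 + 1) → ℝ) ≃ᵐ (Fin 2 → ℝ) × ℝ :=
  (MeasurableEquiv.piFinSuccAbove (fun _ => ℝ) (Fin.last 2)).trans
    (MeasurableEquiv.prodComm.trans (shearHomeo l).toMeasurableEquiv)

/-- The first step of the chart in coordinates. -/
theorem piFinSuccAbove_apply3 (z : Fin (2 + 1) → ℝ) :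
    (MeasurableEquiv.piFinSuccAbove (fun _ => ℝ) (Fin.last 2)) z = (z (Fin.last 2), bse z) := by
  rw [MeasurableEquiv.piFinSuccAbove_apply]
  ext
  · rfl
  · rename_i j
    show z (Fin.succAbove (Fin.last 2) j) = z (Fin.castSucc j)
    rw [Fin.succAbove_last]

/-- **The chart in coordinates.** -/
theorem chart3_apply (l : ℝ × ℝ × ℝ) (z : Fin (2 + 1) → ℝ) :
    chart3 l z = (bse z, z (Fin.last 2) - affv l (bse z)) := by
  simp only [chart3, MeasurableEquiv.trans_apply, piFinSuccAbove_apply3, Homeomorph.toMeasurableEquiv_coe]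
  rfl

/-- **The inverse chart in coordinates**: `(v, w) ↦ (v, w + ℓ(v))`. -/
theorem chart3_symm_apply (l : ℝ × ℝ × ℝ) (p : (Fin 2 → ℝ) × ℝ) :
    (chart3 l).symm p = Fin.snoc p.1 (p.2 + affv l p.1) := by
  have h : chart3 l (Fin.snoc p.1 (p.2 + affv l p.1) : Fin (2 + 1) → ℝ) = p := by
    rw [chart3_apply]
    have hb : bse (Fin.snoc p.1 (p.2 + affv l p.1) : Fin (2 + 1) → ℝ) = p.1 := by
      funext i; simp [bse]
    rw [hb, Fin.snoc_last]
    ext <;> simp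
  rw [← h, MeasurableEquiv.symm_apply_apply, h]

/-- The inverse chart in coordinates: base point. -/
theorem bse_chart3_symm (l : ℝ × ℝ × ℝ) (p : (Fin 2 → ℝ) × ℝ) : bse ((chart3 l).symm p) = p.1 := by
  rw [chart3_symm_apply]
  funext i; simp [bse]

/-- The inverse chart in coordinates: distinguished coordinate. -/
theorem last_chart3_symm (l : ℝ × ℝ × ℝ) (p : (Fin 2 → ℝ) × ℝ) :
    (chart3 l).symm p (Fin.last 2) = p.2 + affv l p.1 := by
  rw [chart3_symm_apply, Fin.snoc_last]

/-- **The chart preserves Lebesgue measure.** -/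
theorem measurePreserving_chart3 (l : ℝ × ℝ × ℝ) :
    MeasurePreserving (chart3 l) (volume : Measure (Fin (2 + 1) → ℝ)) volume := by
  refine (volume_preserving_piFinSuccAbove (fun _ : Fin (2 + 1) => ℝ) (Fin.last 2)).trans ?_
  refine MeasurePreserving.trans ?_ (measurePreserving_shear l)
  exact (Measure.measurePreserving_swap :
    MeasurePreserving Prod.swap ((volume : Measure ℝ).prod (volume : Measure (Fin 2 → ℝ)))
      ((volume : Measure (Fin 2 → ℝ)).prod volume))

/-- The chart is a homeomorphism (continuity in both directions). -/
theorem continuous_chart3 (l : ℝ × ℝ × ℝ) : Continuous (chart3 l) := by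
  have h : (chart3 l : (Fin (2 + 1) → ℝ) → (Fin 2 → ℝ) × ℝ) =
      fun z => (bse z, z (Fin.last 2) - affv l (bse z)) := funext (chart3_apply l)
  rw [h]
  have := continuous_affv l
  unfold bse
  fun_prop

/-- The inverse chart is continuous. -/
theorem continuous_chart3_symm (l : ℝ × ℝ × ℝ) : Continuous (chart3 l).symm := by
  have h : ((chart3 l).symm : (Fin 2 → ℝ) × ℝ → Fin (2 + 1) → ℝ) =
      fun p => (Fin.snoc p.1 (p.2 + affv l p.1) : Fin (2 + 1) → ℝ) := funext (chart3_symm_apply l)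
  rw [h]
  have hc := continuous_affv l
  refine continuous_pi fun k => ?_
  induction k using Fin.lastCases with
  | last => simp only [Fin.snoc_last]; fun_prop
  | cast i => simp only [Fin.snoc_castSucc]; fun_prop

/-- The chart as a homeomorphism. -/
def chart3Homeo (l : ℝ × ℝ × ℝ) : (Fin (2 + 1) → ℝ) ≃ₜ (Fin 2 → ℝ) × ℝ where
  toEquiv := (chart3 l).toEquiv
  continuous_toFun := continuous_chart3 l
  continuous_invFun := continuous_chart3_symm l

/-- Closures are transported by the chart. -/
theorem chart3_symm_preimage_closure (l : ℝ × ℝ × ℝ) (D : Set (Fin (2 + 1) → ℝ)) :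
    (chart3 l).symm ⁻¹' closure D = closure ((chart3 l).symm ⁻¹' D) :=
  (chart3Homeo l).symm.preimage_closure D

end SepThree

/-- **The vertical shear chart preserves Lebesgue measure** (registered part of
`stub_separateThreeZero`; literal form of `SepThree.measurePreserving_chart3`): the measurable
equivalence `z ↦ (x′, y − ℓ(x′))` from `Fin (2 + 1) → ℝ` to `(Fin 2 → ℝ) × ℝ` (`x′ = (z 0, z 1)`,
`y = z 2`, `ℓ(x′) = l₀ z 0 + l₁ z 1 + l₂`) is measure preserving. -/
theorem separateThree_chart (l : ℝ × ℝ × ℝ) : MeasureTheory.MeasurePreserving (SepThree.chart3 l) (MeasureTheory.volume : MeasureTheory.Measure (Fin (2 + 1) → ℝ)) MeasureTheory.volume := by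
  exact SepThree.measurePreserving_chart3 l

end Summit.KontsevichZagierPeriods.ArrangementNormalForm.JanusBands
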